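import Summits.CriticalPhenomena.PercolationContinuityZ3.Theorems.PercNearOneGluingAdditiveGluingSetObserverHtwBridge
import Summits.CriticalPhenomena.PercolationContinuityZ3.Theorems.PercNearOneGluingAdditiveGluingSetObserverK6
import Summits.CriticalPhenomena.PercolationContinuityZ3.Theorems.PercNearOneGluingAdditiveGluingCSHHpart
import HarnessLib

/-!
# Conjecture G / SET-W via a SET observer, XIX: LEMMA H-set — the H-part of the set-observer unfolding is nonnegative (world-sum form)

Support file (`--supports stmt-CriticalPhenomena-4576`); no definitions, no named facts, no sorries.  Seat (b) V⁺-form `png-dp-vplus`, gen 13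
(memo MEMO-gen12.md §4(d), §10 (H)).  Set-observer version of `CSH.hpart_nonneg_of_htw` / `CSH.hpart_nonneg` (`…AdditiveGluingCSHHpart.lean`,
`…CSHHtwBridge.lean`), stated in the world-sum vocabulary `CSH.wcovOff` / `CSH.wmeanOff` consumed by `CSHSet.within_nonneg_of_hpart_set`
(`…SetObserverUnfoldMain.lean`):
* `world_K6_set` — (K6-set) (`SetSurplus.covTransfer_relaySet_edge_set`, gen 12) in every world `G ∖ C_Y(ω)`, in sum form:
  `μ_ω(O~v, O≁S)·Cov_ω(g(C_x), 1{v↔S}) ≤ μ_ω(v↮S)·Cov_ω(g(C_x), 1{O~S})` (transport by `BHK2006.integral_comp_sdiff_prodBernoulli`);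
* `wmeanOff_avoid_pos` — `μ_ω(v ↮ S) > 0` in every world (weights `< 1`; the empty configuration);
* **`hpart_set_sum_nonneg`** — LEMMA H-set: for weights `< 1`, `x ∈ S`, `v ∉ S`, `v ∉ Y`, `g` monotone `≥ 0`,
  `0 ≤ Σ_ω w(ω) 1{x↮Y}(ω) [ℓ(ω)·Cov_ω(g(C_x), 1{O ~ S}) − p·Cov_ω(g(C_x), 1{v ↔ S})]`, `ℓ(ω) = 1{∀ o ∈ O, o ↮ Y}`,
  `p = μ(O~v, O≁S∪Y)/μ(v↮S∪Y)` (`CSHSet.obsConstSet`): (K6-set) world by world and (Htw-set) `CovTau.htw_set_sum`.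
[cite: VandenbergHaggstromKahn2005, Thm. 1.1 (pp. 3–5), Thm. 1.4 (p. 7), Thm. 2.1 (p. 9), §2.1 Lemmas 2.3–2.4 (p. 10)]
[cite: KozmaNitzan2024, Conj. 4 (p. 32)]
-/

noncomputable section

namespace Summit.CriticalPhenomena.PercolationContinuityZ3.Theorems.CSHSet

open MeasureTheory Set
open Literature.Probability.LatticeModels (prodBernoulli)
open Literature.Probability.Percolation
open Literature.Probability.Percolation.BHK2006 (weight weight_nonneg integral_prodBernoulli_eq_sum)
open Literature.Probability.Percolation.DecisionTree (ind ind_of_mem ind_of_not_mem ind_nonneg)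
open CSH HullPort CovTau
open scoped Classical

variable {V : Type*} [Fintype V]

/-- A world mean is the integral under any weight vector realising the world (transport hypothesis `hp'`). [folklore] -/
theorem wmeanOff_eq_integral (w : Sym2 V → unitInterval) (Y : Set V) (ω : Set (Sym2 V)) (p' : Sym2 V → unitInterval)
    (hp' : ∀ F : Set (Sym2 V) → ℝ, ∫ η, F (η \ cut Y ω) ∂(prodBernoulli w) = ∫ η, F η ∂(prodBernoulli p')) (φ : Set (Sym2 V) → ℝ) :
    wmeanOff (fun e => (w e : ℝ)) Y φ ω = ∫ η, φ η ∂(prodBernoulli p') := by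
  rw [wmeanOff, ← hp' φ, integral_prodBernoulli_eq_sum]

/-- **(K6-set) in a world, sum form**: for `x ∈ S`, `g` monotone `≥ 0` and every world `G ∖ C_Y(ω)`,
`μ_ω({O~v} ∩ {O≁S}) · Cov_ω(g(C_x), 1{v ↔ S}) ≤ μ_ω(v ↮ S) · Cov_ω(g(C_x), 1{O ~ S})` (world means `CSH.wmeanOff`, world covariances `CSH.wcovOff`).
[cite: VandenbergHaggstromKahn2005, Thm. 2.1 (p. 9), §2.1 Lemma 2.3 (p. 10)] -/
theorem world_K6_set (w : Sym2 V → unitInterval) (Y : Set V) (ω : Set (Sym2 V)) (S O : Finset V) (v x : V) (hxS : x ∈ S)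
    (g : Set (Sym2 V) → ℝ) (hg : Monotone g) (hg0 : ∀ C, 0 ≤ g C) :
    wmeanOff (fun e => (w e : ℝ)) Y (ind ({ζ : Set (Sym2 V) | ∃ o ∈ O, (openGraph ζ).Reachable o v} ∩
        {ζ | ∀ o ∈ O, ∀ t ∈ S, ¬ (openGraph ζ).Reachable o t})) ω *
      wcovOff (fun e => (w e : ℝ)) Y (fun β => g (openEdgeCluster β x)) (ind (⋃ t ∈ S, (openConn v t : Set (BondConfig V)))) ω ≤
    wmeanOff (fun e => (w e : ℝ)) Y (ind {ζ : Set (Sym2 V) | ∀ t ∈ S, ¬ (openGraph ζ).Reachable v t}) ω *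
      wcovOff (fun e => (w e : ℝ)) Y (fun β => g (openEdgeCluster β x))
        (ind {ζ : Set (Sym2 V) | ∃ o ∈ O, ∃ t ∈ S, (openGraph ζ).Reachable o t}) ω := by
  -- any weight vector realising the world
  suffices key : ∀ p' : Sym2 V → unitInterval,
      (∀ F : Set (Sym2 V) → ℝ, ∫ η, F (η \ cut Y ω) ∂(prodBernoulli w) = ∫ η, F η ∂(prodBernoulli p')) →
      wmeanOff (fun e => (w e : ℝ)) Y (ind ({ζ : Set (Sym2 V) | ∃ o ∈ O, (openGraph ζ).Reachable o v} ∩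
          {ζ | ∀ o ∈ O, ∀ t ∈ S, ¬ (openGraph ζ).Reachable o t})) ω *
        wcovOff (fun e => (w e : ℝ)) Y (fun β => g (openEdgeCluster β x)) (ind (⋃ t ∈ S, (openConn v t : Set (BondConfig V)))) ω ≤
      wmeanOff (fun e => (w e : ℝ)) Y (ind {ζ : Set (Sym2 V) | ∀ t ∈ S, ¬ (openGraph ζ).Reachable v t}) ω *
        wcovOff (fun e => (w e : ℝ)) Y (fun β => g (openEdgeCluster β x))
          (ind {ζ : Set (Sym2 V) | ∃ o ∈ O, ∃ t ∈ S, (openGraph ζ).Reachable o t}) ω from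
    key _ (fun F => BHK2006.integral_comp_sdiff_prodBernoulli w (cut Y ω) F)
  intro p' hp'
  have hK6 := SetSurplus.covTransfer_relaySet_edge_set p' S O v x hxS g hg hg0
  -- dictionary: world means as `p'`-integrals
  have hmean := wmeanOff_eq_integral w Y ω p' hp'
  have hreal : ∀ E : Set (Set (Sym2 V)), wmeanOff (fun e => (w e : ℝ)) Y (ind E) ω = (prodBernoulli p').real E := by
    intro E
    have hfun : (ind E : Set (Sym2 V) → ℝ) = E.indicator (1 : Set (Sym2 V) → ℝ) := by
      funext η
      by_cases h : η ∈ E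
      · rw [ind_of_mem h, Set.indicator_of_mem h, Pi.one_apply]
      · rw [ind_of_not_mem h, Set.indicator_of_notMem h]
    rw [hmean, hfun, integral_indicator_one MeasurableSet.of_discrete]
  have hset : ∀ C : Set (Set (Sym2 V)), wmeanOff (fun e => (w e : ℝ)) Y (fun β => g (openEdgeCluster β x) * ind C β) ω =
      ∫ η in C, g (openEdgeCluster η x) ∂(prodBernoulli p') := by
    intro C
    rw [hmean, ← integral_indicator MeasurableSet.of_discrete]
    congr 1
    funext η
    by_cases h : η ∈ C
    · rw [ind_of_mem h, mul_one, Set.indicator_of_mem h]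
    · rw [ind_of_not_mem h, mul_zero, Set.indicator_of_notMem h]
  have hcov : ∀ C : Set (Set (Sym2 V)), wcovOff (fun e => (w e : ℝ)) Y (fun β => g (openEdgeCluster β x)) (ind C) ω =
      (∫ η in C, g (openEdgeCluster η x) ∂(prodBernoulli p')) -
        (prodBernoulli p').real C * ∫ η, g (openEdgeCluster η x) ∂(prodBernoulli p') := by
    intro C
    rw [wcovOff, hset C, hreal C, hmean]
    ring
  have hD : ({ζ : Set (Sym2 V) | ∀ t ∈ S, ¬ (openGraph ζ).Reachable v t} : Set (Set (Sym2 V))) =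
      {ω : BondConfig V | ∀ t ∈ S, ¬ (openGraph ω).Reachable v t} := rfl
  rw [hreal, hreal, hcov, hcov]
  exact hK6

/-- **`μ_ω(v ↮ S) > 0` in every world** for weights `< 1` and `v ∉ S`: the empty configuration has positive weight. [folklore] -/
theorem wmeanOff_avoid_pos (w : Sym2 V → unitInterval) (hw : ∀ e, w e < 1) (Y : Set V) (ω : Set (Sym2 V)) (S : Finset V) (v : V)
    (hvS : v ∉ S) :
    0 < wmeanOff (fun e => (w e : ℝ)) Y (ind {ζ : Set (Sym2 V) | ∀ t ∈ S, ¬ (openGraph ζ).Reachable v t}) ω := by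
  have hw0 : ∀ e, 0 ≤ (w e : ℝ) := fun e => (w e).2.1
  have hw1 : ∀ e, (w e : ℝ) ≤ 1 := fun e => (w e).2.2
  unfold wmeanOff
  have hterm : ∀ η : Set (Sym2 V), 0 ≤ weight (fun e => (w e : ℝ)) η *
      ind {ζ : Set (Sym2 V) | ∀ t ∈ S, ¬ (openGraph ζ).Reachable v t} (η \ cut Y ω) :=
    fun η => mul_nonneg (weight_nonneg hw0 hw1 η) (ind_nonneg _ _)
  have hempty : (∅ : Set (Sym2 V)) \ cut Y ω ∈ {ζ : Set (Sym2 V) | ∀ t ∈ S, ¬ (openGraph ζ).Reachable v t} := by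
    intro t ht hreach
    rw [Set.empty_sdiff] at hreach
    have hbot : openGraph (∅ : BondConfig V) = ⊥ := by
      unfold openGraph; exact SimpleGraph.fromEdgeSet_empty
    rw [hbot, SimpleGraph.reachable_bot] at hreach
    exact hvS (hreach ▸ ht)
  have hwe : 0 < weight (fun e => (w e : ℝ)) ∅ := by
    unfold weight
    refine Finset.prod_pos fun e _ => ?_
    rw [if_neg (Set.notMem_empty e)]
    exact sub_pos.2 (unitInterval.coe_lt_one.2 (hw e))
  have hone : weight (fun e => (w e : ℝ)) ∅ * ind {ζ : Set (Sym2 V) | ∀ t ∈ S, ¬ (openGraph ζ).Reachable v t} (∅ \ cut Y ω) =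
      weight (fun e => (w e : ℝ)) ∅ := by rw [ind_of_mem hempty, mul_one]
  calc (0 : ℝ) < weight (fun e => (w e : ℝ)) ∅ := hwe
    _ = weight (fun e => (w e : ℝ)) ∅ * ind {ζ : Set (Sym2 V) | ∀ t ∈ S, ¬ (openGraph ζ).Reachable v t} (∅ \ cut Y ω) := hone.symm
    _ ≤ ∑ η, weight (fun e => (w e : ℝ)) η * ind {ζ : Set (Sym2 V) | ∀ t ∈ S, ¬ (openGraph ζ).Reachable v t} (η \ cut Y ω) :=
        Finset.single_le_sum (fun η _ => hterm η) (Finset.mem_univ _)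

/-- **LEMMA H-set** (memo §4(d)): for weights `< 1`, a marker set `S ∋ x` (owner and decoys), a vertex observer `v ∉ S`, `v ∉ Y`, an observer set
`O`, and a monotone edge-cluster functional `g ≥ 0`, the H-part of the world-wise set-observer unfolding is nonnegative:
`0 ≤ Σ_ω w(ω) 1{x↮Y}(ω) [1{∀ o ∈ O, o ↮ Y}(ω)·Cov_ω(g(C_x), 1{O ~ S}) − p·Cov_ω(g(C_x), 1{v ↔ S})]`, `p = μ({O~v} ∩ {O ≁ S∪Y})/μ(v↮S∪Y)`
((K6-set) world by world gives `1{live}·Cov_ω(g,1{O~S}) ≥ 1{live}·q_ω·Cov_ω(g,1{v↔S})`, and (Htw-set) trades `1{live}·q_ω` for the global `p`).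
[cite: VandenbergHaggstromKahn2005, Thm. 1.1 (pp. 3–5), Thm. 2.1 (p. 9)] [cite: KozmaNitzan2024, Conj. 4 (p. 32)] -/
theorem hpart_set_sum_nonneg (w : Sym2 V → unitInterval) (hw : ∀ e, w e < 1) (x : V) (Y : Set V) (S : Finset V) (hxS : x ∈ S)
    (O : Finset V) (v : V) (hvS : v ∉ S) (hvY : v ∉ Y) (g : Set (Sym2 V) → ℝ) (hg : Monotone g) (hg0 : ∀ C, 0 ≤ g C) :
    0 ≤ ∑ ω, weight (fun e => (w e : ℝ)) ω * (ind (avoidEv x Y) ω *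
        (ind {β : Set (Sym2 V) | ∀ o ∈ O, β ∈ avoidEv o Y} ω *
            wcovOff (fun e => (w e : ℝ)) Y (fun β => g (openEdgeCluster β x))
              (ind {ζ' : Set (Sym2 V) | ∃ o ∈ O, ∃ t ∈ S, (openGraph ζ').Reachable o t}) ω -
          obsConstSet w O v (↑S ∪ Y) * wcovOff (fun e => (w e : ℝ)) Y (fun β => g (openEdgeCluster β x))
              (ind (⋃ t ∈ S, (openConn v t : Set (BondConfig V)))) ω)) := by
  set ŵ : Sym2 V → ℝ := fun e => (w e : ℝ) with hŵ
  have hw0 : ∀ e, 0 ≤ ŵ e := fun e => (w e).2.1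
  have hw1 : ∀ e, ŵ e ≤ 1 := fun e => (w e).2.2
  set G : Set (Sym2 V) → ℝ := fun β => g (openEdgeCluster β x) with hG
  set CO : Set (Set (Sym2 V)) := {ζ' : Set (Sym2 V) | ∃ o ∈ O, ∃ t ∈ S, (openGraph ζ').Reachable o t} with hCO
  set Cv : Set (Set (Sym2 V)) := ⋃ t ∈ S, (openConn v t : Set (BondConfig V)) with hCv
  set EO : Set (Set (Sym2 V)) := {ζ : Set (Sym2 V) | ∃ o ∈ O, (openGraph ζ).Reachable o v} ∩
    {ζ | ∀ o ∈ O, ∀ t ∈ S, ¬ (openGraph ζ).Reachable o t} with hEO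
  set Dv : Set (Set (Sym2 V)) := {ζ : Set (Sym2 V) | ∀ t ∈ S, ¬ (openGraph ζ).Reachable v t} with hDv
  set ℓ : Set (Sym2 V) → ℝ := fun ω => ind {β : Set (Sym2 V) | ∀ o ∈ O, β ∈ avoidEv o Y} ω with hℓ
  set q : Set (Sym2 V) → ℝ := fun ω => wmeanOff ŵ Y (ind EO) ω / wmeanOff ŵ Y (ind Dv) ω with hq
  -- the global constant `p` and the positivity of its denominator
  set M : ℝ := (prodBernoulli w).real {ω : BondConfig V | ∀ a ∈ (↑S ∪ Y : Set V), ¬ (openGraph ω).Reachable v a} with hM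
  set E : ℝ := (prodBernoulli w).real ({ω : BondConfig V | ∃ o ∈ O, (openGraph ω).Reachable o v} ∩
    {ω | ∀ o ∈ O, ∀ a ∈ (↑S : Set V) ∪ Y, ¬ (openGraph ω).Reachable o a}) with hE
  have hMpos : 0 < M := by
    refine prodBernoulli_real_pos_of_empty_mem w hw (fun a ha hreach => ?_)
    have hbot : openGraph (∅ : BondConfig V) = ⊥ := by
      unfold openGraph; exact SimpleGraph.fromEdgeSet_empty
    rw [hbot, SimpleGraph.reachable_bot] at hreach
    subst hreach
    rcases ha with ha | ha
    · exact hvS (Finset.mem_coe.1 ha)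
    · exact hvY ha
  have hobs : obsConstSet w O v (↑S ∪ Y) = E / M := by unfold obsConstSet obsEv; rfl
  -- (K6-set) in each world, divided by `μ_ω(v ↮ S) > 0`
  have hworld : ∀ ω, q ω * wcovOff ŵ Y G (ind Cv) ω ≤ wcovOff ŵ Y G (ind CO) ω := by
    intro ω
    have hK6 := world_K6_set w Y ω S O v x hxS g hg hg0
    have hpos := wmeanOff_avoid_pos w hw Y ω S v hvS
    rw [hq]
    dsimp only
    rw [div_mul_eq_mul_div, div_le_iff₀ hpos]
    linarith [hK6, mul_comm (wmeanOff ŵ Y (ind Dv) ω) (wcovOff ŵ Y G (ind CO) ω)]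
  -- (Htw-set), divided by `M`
  have hHtw := htw_set_sum w x Y S hxS O v hvS g hg hg0
  have hI2 : E / M * ∑ ω, weight ŵ ω * (ind (avoidEv x Y) ω * wcovOff ŵ Y G (ind Cv) ω) ≤
      ∑ ω, weight ŵ ω * (ind (avoidEv x Y) ω * (ℓ ω * q ω * wcovOff ŵ Y G (ind Cv) ω)) := by
    rw [div_mul_eq_mul_div, div_le_iff₀ hMpos]
    have := hHtw
    linarith [this, mul_comm M (∑ ω, weight ŵ ω * (ind (avoidEv x Y) ω * (ℓ ω * q ω * wcovOff ŵ Y G (ind Cv) ω)))]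
  -- the world inequality summed with the nonnegative weights `w 1_D ℓ`
  have hI1 : ∑ ω, weight ŵ ω * (ind (avoidEv x Y) ω * (ℓ ω * q ω * wcovOff ŵ Y G (ind Cv) ω)) ≤
      ∑ ω, weight ŵ ω * (ind (avoidEv x Y) ω * (ℓ ω * wcovOff ŵ Y G (ind CO) ω)) := by
    refine Finset.sum_le_sum fun ω _ => mul_le_mul_of_nonneg_left (mul_le_mul_of_nonneg_left ?_ (ind_nonneg _ _)) (weight_nonneg hw0 hw1 ω)
    have hl : 0 ≤ ℓ ω := ind_nonneg _ _
    calc ℓ ω * q ω * wcovOff ŵ Y G (ind Cv) ω = ℓ ω * (q ω * wcovOff ŵ Y G (ind Cv) ω) := by ring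
      _ ≤ ℓ ω * wcovOff ŵ Y G (ind CO) ω := mul_le_mul_of_nonneg_left (hworld ω) hl
  -- assemble
  have e : ∑ ω, weight ŵ ω * (ind (avoidEv x Y) ω * (ℓ ω * wcovOff ŵ Y G (ind CO) ω - obsConstSet w O v (↑S ∪ Y) * wcovOff ŵ Y G (ind Cv) ω)) =
      (∑ ω, weight ŵ ω * (ind (avoidEv x Y) ω * (ℓ ω * wcovOff ŵ Y G (ind CO) ω))) -
        E / M * ∑ ω, weight ŵ ω * (ind (avoidEv x Y) ω * wcovOff ŵ Y G (ind Cv) ω) := by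
    rw [hobs, Finset.mul_sum, ← Finset.sum_sub_distrib]
    exact Finset.sum_congr rfl fun ω _ => by ring
  rw [e]
  linarith [hI1, hI2]

end Summit.CriticalPhenomena.PercolationContinuityZ3.Theorems.CSHSet

end
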